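import Literature.Topology.PlaneTopology.Schoenflies
import Literature.Probability.RandomPlanarGeometry.ArcHullDomains
import HarnessLib

/-!
# Outer squeezes, part 4: a closed half-plane chart of a Jordan domain punctured at a boundary point

Support file (`--supports stmt-CriticalPhenomena-0773`, towards the registered stub `stub_squeezeFamily`) of
the line `birth` for the crux `RestrictionOfLimit`. Pure plane topology, no probability.

For a Jordan domain `D` and a boundary point `b ∈ ∂D` we build a homeomorphism `Ψ` of the closed upper
half-plane `ℍ̄ = {im ≥ 0}` onto `cl D ∖ {b}` mapping `ℍ` onto `D` and `ℝ` onto `∂D ∖ {b}`, open on `ℍ`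
(`HChart`, `nonempty_hChart`): `Ψ = H ∘ (ζ · C)` where `C(z) = (z - i)/(z + i)` is the Cayley map (tree:
`cayleyFun`, `C(∞) = 1`), `H : ℂ ≃ₜ ℂ` is the Schoenflies extension of a Carathéodory chart of `D` (tree:
`JordanDomain.DiscChart.exists_homeomorph_eqOn`, from the Riemann mapping theorem, Carathéodory's theorem and
the Jordan curve theorem, all discharged) and `ζ = H⁻¹ b`. Only the TOPOLOGY of the chart is used downstream
(neighbourhood transport `exists_nhds_inter_closure_subset`, closures `inv_mem_closure`).

References: Ch. Pommerenke, *Boundary Behaviour of Conformal Maps* (1992), Thm 2.6 and Cor. 2.8. Axioms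
`propext`, `Classical.choice`, `Quot.sound`.
-/

noncomputable section

open Set Filter Topology Metric Complex
open Literature.Probability.RandomPlanarGeometry Literature.Topology.PlaneTopology

namespace Summit.CriticalPhenomena.SAWScalingLimit.Theorems.RestrictionOfLimit.Birth

/-- A **closed half-plane chart** of the Jordan domain `D` punctured at the boundary point `b`: a
homeomorphism `Ψ : ℍ̄ → cl D ∖ {b}` (with inverse `Ψinv`) taking `ℍ` onto `D`, open on `ℍ`. [folklore] -/
structure HChart (D : JordanDomain) (b : ℂ) where
  /-- The chart. -/
  Ψ : ℂ → ℂ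
  /-- Its inverse. -/
  Ψinv : ℂ → ℂ
  /-- Continuity on `ℍ̄`. -/
  continuousOn : ContinuousOn Ψ {z | 0 ≤ z.im}
  /-- Continuity of the inverse on `cl D ∖ {b}`. -/
  continuousOn_inv : ContinuousOn Ψinv (closure D.carrier \ {b})
  /-- `ℍ̄` goes into `cl D ∖ {b}`. -/
  mapsTo : MapsTo Ψ {z | 0 ≤ z.im} (closure D.carrier \ {b})
  /-- `cl D ∖ {b}` goes into `ℍ̄`. -/
  mapsTo_inv : MapsTo Ψinv (closure D.carrier \ {b}) {z | 0 ≤ z.im}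
  /-- Left inverse. -/
  left_inv : ∀ z : ℂ, 0 ≤ z.im → Ψinv (Ψ z) = z
  /-- Right inverse. -/
  right_inv : ∀ w ∈ closure D.carrier \ {b}, Ψ (Ψinv w) = w
  /-- Exactly `ℍ` goes into `D`. -/
  mem_carrier_iff : ∀ z : ℂ, 0 ≤ z.im → (Ψ z ∈ D.carrier ↔ 0 < z.im)
  /-- The chart is open on `ℍ`. -/
  isOpen_image : ∀ V : Set ℂ, IsOpen V → V ⊆ {z | 0 < z.im} → IsOpen (Ψ '' V)

/-- The inverse Cayley map sends the closed disc minus `1` into `ℍ̄`. [folklore] -/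
theorem cayleyInvFun_im_nonneg {w : ℂ} (hw : ‖w‖ ≤ 1) : 0 ≤ (cayleyInvFun w).im := by
  rw [cayleyInvFun_im]
  refine div_nonneg ?_ (normSq_nonneg _)
  rw [sub_nonneg, normSq_eq_norm_sq]
  exact pow_le_one₀ (norm_nonneg _) hw

/-- **Closed half-plane charts exist** at every boundary point of a Jordan domain. [folklore] -/
theorem nonempty_hChart (D : JordanDomain) {b : ℂ} (hb : b ∈ frontier D.carrier) : Nonempty (HChart D b) := by
  obtain ⟨z₀, hz₀⟩ := D.nonempty
  obtain ⟨C, -⟩ := D.exists_discChart_apply_eq hz₀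
  obtain ⟨H, -, hHball, hHsph, hHcl, -⟩ := C.exists_homeomorph_eqOn
  set ζ : ℂ := H.symm b with hζ_def
  have hHζ : H ζ = b := H.apply_symm_apply b
  have hζ1 : ‖ζ‖ = 1 := by
    rw [← hHsph] at hb
    obtain ⟨u, hu, hub⟩ := hb
    rw [hζ_def, ← hub, H.symm_apply_apply]
    exact mem_sphere_zero_iff_norm.1 hu
  have hζ0 : ζ ≠ 0 := fun h ↦ by rw [h, norm_zero] at hζ1; exact zero_ne_one hζ1
  have hζinv : ‖ζ⁻¹‖ = 1 := by rw [norm_inv, hζ1, inv_one]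
  -- the two maps
  set Ψ : ℂ → ℂ := fun z ↦ H (ζ * cayleyFun z) with hΨ
  set Ψinv : ℂ → ℂ := fun w ↦ cayleyInvFun (ζ⁻¹ * H.symm w) with hΨinv
  have hcl : ∀ {u : ℂ}, H u ∈ closure D.carrier ↔ ‖u‖ ≤ 1 := fun {u} ↦ by
    rw [← hHcl, H.injective.mem_set_image, mem_closedBall_zero_iff]
  have hball : ∀ {u : ℂ}, H u ∈ D.carrier ↔ ‖u‖ < 1 := fun {u} ↦ by
    rw [← hHball, H.injective.mem_set_image, mem_ball_zero_iff]
  have hne1 : ∀ {w : ℂ}, w ≠ b → ζ⁻¹ * H.symm w ≠ 1 := fun {w} hw h ↦ hw (by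
    have : H.symm w = ζ := by
      have := congrArg (ζ * ·) h
      simpa [hζ0] using this
    rw [← H.apply_symm_apply w, this, hHζ])
  refine ⟨⟨Ψ, Ψinv, ?_, ?_, ?_, ?_, ?_, ?_, ?_, ?_⟩⟩
  · exact H.continuous.comp_continuousOn ((continuousOn_const.mul continuousOn_cayleyFun).mono
      fun z (hz : 0 ≤ z.im) ↦ add_I_ne_zero hz)
  · refine (differentiableOn_cayleyInvFun.continuousOn).comp
      ((continuous_const.mul H.symm.continuous).continuousOn) fun w hw ↦ hne1 hw.2
  · intro z hz
    refine ⟨hcl.2 (by rw [norm_mul, hζ1, one_mul]; exact norm_cayleyFun_le_one hz), fun h ↦ ?_⟩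
    have h1 : ζ * cayleyFun z = ζ := H.injective (h.trans hHζ.symm)
    exact cayleyFun_ne_one z (by simpa [hζ0] using congrArg (ζ⁻¹ * ·) h1)
  · intro w hw
    show 0 ≤ (cayleyInvFun (ζ⁻¹ * H.symm w)).im
    refine cayleyInvFun_im_nonneg ?_
    rw [norm_mul, hζinv, one_mul, ← hcl, H.apply_symm_apply]
    exact hw.1
  · intro z hz
    show cayleyInvFun (ζ⁻¹ * H.symm (H (ζ * cayleyFun z))) = z
    rw [H.symm_apply_apply, ← mul_assoc, inv_mul_cancel₀ hζ0, one_mul,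
      cayleyInvFun_cayleyFun (add_I_ne_zero hz)]
  · intro w hw
    show H (ζ * cayleyFun (cayleyInvFun (ζ⁻¹ * H.symm w))) = w
    rw [cayleyFun_cayleyInvFun (hne1 hw.2), ← mul_assoc, mul_inv_cancel₀ hζ0, one_mul, H.apply_symm_apply]
  · intro z hz
    show H (ζ * cayleyFun z) ∈ D.carrier ↔ 0 < z.im
    rw [hball, norm_mul, hζ1, one_mul, norm_cayleyFun_lt_one_iff (add_I_ne_zero hz)]
  · intro V hV hVsub
    have h1 : IsOpen (cayleyFun '' V) := cayley.isOpen_image isOpen_ball hV hVsub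
    have h2 : IsOpen ((fun u ↦ ζ * u) '' (cayleyFun '' V)) := (Homeomorph.mulLeft₀ ζ hζ0).isOpenMap _ h1
    have h3 : Ψ '' V = H '' ((fun u ↦ ζ * u) '' (cayleyFun '' V)) := by
      rw [image_image, image_image]
    rw [h3]
    exact H.isOpenMap _ h2

namespace HChart

variable {D : JordanDomain} {b : ℂ} (χ : HChart D b)

/-- The chart is injective on `ℍ̄`. [folklore] -/
theorem injOn : InjOn χ.Ψ {z | 0 ≤ z.im} := fun z hz w hw h ↦ by
  rw [← χ.left_inv z hz, ← χ.left_inv w hw, h]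

/-- Real points go to the boundary. [folklore] -/
theorem apply_mem_frontier {z : ℂ} (hz : z.im = 0) : χ.Ψ z ∈ frontier D.carrier := by
  refine ⟨(χ.mapsTo hz.ge).1, fun h ↦ ?_⟩
  rw [D.isOpen.interior_eq] at h
  exact (lt_irrefl (0 : ℝ)) (hz ▸ (χ.mem_carrier_iff z hz.ge).1 h)

/-- Points of `ℍ̄` never go to `b`. [folklore] -/
theorem apply_ne {z : ℂ} (hz : 0 ≤ z.im) : χ.Ψ z ≠ b := (χ.mapsTo hz).2

/-- Points of `ℍ` go into `D`. [folklore] -/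
theorem apply_mem_carrier {z : ℂ} (hz : 0 < z.im) : χ.Ψ z ∈ D.carrier :=
  (χ.mem_carrier_iff z hz.le).2 hz

/-- Surjectivity: every point of `cl D ∖ {b}` is a value of the chart on `ℍ̄`. [folklore] -/
theorem exists_eq {w : ℂ} (hw : w ∈ closure D.carrier) (hwb : w ≠ b) :
    ∃ z : ℂ, 0 ≤ z.im ∧ χ.Ψ z = w :=
  ⟨χ.Ψinv w, χ.mapsTo_inv ⟨hw, hwb⟩, χ.right_inv w ⟨hw, hwb⟩⟩

/-- The inverse undoes the chart on subsets of `ℍ̄`. [folklore] -/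
theorem image_inv_image {C : Set ℂ} (hC : C ⊆ {z | 0 ≤ z.im}) : χ.Ψinv '' (χ.Ψ '' C) = C := by
  rw [image_image]
  refine Subset.antisymm ?_ fun z hz ↦ ⟨z, hz, χ.left_inv z (hC hz)⟩
  rintro _ ⟨z, hz, rfl⟩
  show χ.Ψinv (χ.Ψ z) ∈ C
  rw [χ.left_inv z (hC hz)]
  exact hz

/-- **Neighbourhood transport.** The chart maps neighbourhoods within `ℍ̄` onto neighbourhoods within
`cl D`. [folklore] -/
theorem exists_nhds_inter_closure_subset {z : ℂ} (hz : 0 ≤ z.im) {V : Set ℂ} (hV : V ∈ 𝓝 z) :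
    ∃ O ∈ 𝓝 (χ.Ψ z), O ∩ closure D.carrier ⊆ χ.Ψ '' (V ∩ {w | 0 ≤ w.im}) := by
  have hw₀ : χ.Ψ z ∈ closure D.carrier \ {b} := χ.mapsTo hz
  have hc : ContinuousWithinAt χ.Ψinv (closure D.carrier \ {b}) (χ.Ψ z) := χ.continuousOn_inv _ hw₀
  have hV' : V ∈ 𝓝 (χ.Ψinv (χ.Ψ z)) := by rwa [χ.left_inv z hz]
  obtain ⟨O, hO, hOV⟩ := mem_nhdsWithin_iff_exists_mem_nhds_inter.1 (hc.preimage_mem_nhdsWithin hV')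
  refine ⟨O ∩ {b}ᶜ, inter_mem hO (isOpen_compl_singleton.mem_nhds hw₀.2), ?_⟩
  rintro w ⟨⟨hwO, hwb⟩, hwcl⟩
  have hw : w ∈ closure D.carrier \ {b} := ⟨hwcl, hwb⟩
  exact ⟨χ.Ψinv w, ⟨hOV ⟨hwO, hw⟩, χ.mapsTo_inv hw⟩, χ.right_inv w hw⟩

/-- **Closure transport.** A point of `cl D ∖ {b}` adherent to the image of `C ⊆ ℍ̄` has its preimage
adherent to `C`. [folklore] -/
theorem inv_mem_closure {C : Set ℂ} (hC : C ⊆ {z | 0 ≤ z.im}) {w : ℂ} (hw : w ∈ closure D.carrier)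
    (hwb : w ≠ b) (hwC : w ∈ closure (χ.Ψ '' C)) : χ.Ψinv w ∈ closure C := by
  have hc : ContinuousWithinAt χ.Ψinv (χ.Ψ '' C) w :=
    (χ.continuousOn_inv w ⟨hw, hwb⟩).mono (by rintro _ ⟨z, hz, rfl⟩; exact χ.mapsTo (hC hz))
  have := hc.mem_closure_image hwC
  rwa [χ.image_inv_image hC] at this

/-- Images of subsets of `ℍ̄` lie in `cl D`. [folklore] -/
theorem image_subset_closure {C : Set ℂ} (hC : C ⊆ {z | 0 ≤ z.im}) : χ.Ψ '' C ⊆ closure D.carrier := by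
  rintro _ ⟨z, hz, rfl⟩; exact (χ.mapsTo (hC hz)).1

/-- The image of a simple arc in `ℍ̄` is a simple arc. [folklore] -/
theorem isSimpleArc_image {L : Set ℂ} {p q : ℂ} (hL : IsSimpleArc L p q) (hLH : L ⊆ {z | 0 ≤ z.im}) :
    IsSimpleArc (χ.Ψ '' L) (χ.Ψ p) (χ.Ψ q) := by
  obtain ⟨γ, hγ, hinj, hγL, h0, h1⟩ := hL
  have hγH : MapsTo γ (Icc 0 1) {z | 0 ≤ z.im} := fun t ht ↦ hLH (hγL ▸ mem_image_of_mem γ ht)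
  refine ⟨fun t ↦ χ.Ψ (γ t), χ.continuousOn.comp hγ hγH, fun s hs t ht h ↦
    hinj hs ht (χ.injOn (hγH hs) (hγH ht) h), ?_, by simp only [h0], by simp only [h1]⟩
  rw [← hγL, image_image]

end HChart

/-- **Registered helper stub `stub_squeezeHChart`** (towards `stub_squeezeFamily`, line `birth`): closed
half-plane charts punctured at a boundary point exist, in closed form. [folklore] -/
theorem stub_squeezeHChart :
    ∀ (D : JordanDomain) (b : ℂ), b ∈ frontier D.carrier →
      ∃ Ψ Ψinv : ℂ → ℂ, ContinuousOn Ψ {z | 0 ≤ z.im} ∧ ContinuousOn Ψinv (closure D.carrier \ {b}) ∧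
        Set.MapsTo Ψ {z | 0 ≤ z.im} (closure D.carrier \ {b}) ∧
        Set.MapsTo Ψinv (closure D.carrier \ {b}) {z | 0 ≤ z.im} ∧
        (∀ z : ℂ, 0 ≤ z.im → Ψinv (Ψ z) = z) ∧ (∀ w ∈ closure D.carrier \ {b}, Ψ (Ψinv w) = w) ∧
        (∀ z : ℂ, 0 ≤ z.im → (Ψ z ∈ D.carrier ↔ 0 < z.im)) ∧
        (∀ V : Set ℂ, IsOpen V → V ⊆ {z | 0 < z.im} → IsOpen (Ψ '' V)) := by
  intro D b hb
  obtain ⟨χ⟩ := nonempty_hChart D hb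
  exact ⟨χ.Ψ, χ.Ψinv, χ.continuousOn, χ.continuousOn_inv, χ.mapsTo, χ.mapsTo_inv, χ.left_inv, χ.right_inv,
    χ.mem_carrier_iff, χ.isOpen_image⟩

end Summit.CriticalPhenomena.SAWScalingLimit.Theorems.RestrictionOfLimit.Birth

end
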